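import Mathlib.Analysis.Analytic.CPolynomial
import Mathlib.Analysis.Analytic.IteratedFDeriv
import Mathlib.Analysis.Calculus.ContDiff.FiniteDimension
import Mathlib.Data.List.FinRange
import Literature.Analysis.Distribution.NormalFlatVanishing
import HarnessLib

/-!
# Normal jets as multilinear maps, and their prescription by lifted test functions

Topic `Analysis/Distribution`; namespace `Literature.Analysis.Distribution`. Continuation of
`NormalJetCalculus` / `NormalFlatVanishing` (Hörmander, Thm. 2.3.3 and the structure of distributions
carried by a linear subspace `{0} × Z ⊂ B × Z`, Schwartz):

* §1 the **normal jet of order `j`** of `h` along `{0} × Z` as a continuous `j`-linear map on `B`,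
  `normalJet j h z = D^j h(0, z) ∘ (inl, …, inl)`; it computes the normal word derivatives
  (`vecWordDeriv_normalWord_ofFn`), so `NormalJetsVanishBelow j h ↔ ∀ i < j, normalJet i h = 0`; it is
  symmetric, local, linear in `h`, smooth and compactly supported in `z`;
* §2 the **symmetrisation** `symmetrize m = (j!)⁻¹ Σ_σ m ∘ σ` and the **diagonal** `b ↦ m(b, …, b)` of a
  `j`-linear map: its `i`-th derivative at `0` is `j! · symmetrize m` for `i = j`
  (`ContinuousMultilinearMap.iteratedFDeriv_comp_diagonal`) and `0` for `i ≠ j` (homogeneity);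
* §3 the **jet lift** `jetLift ε ν (b, z) = χ(b/ε) (j!)⁻¹ ν(z)(b, …, b)` of a smooth compactly supported
  `ν : Z → (B^{⊗j})^*`: a test function with `normalJet i (jetLift ε ν) = 0` for `i ≠ j` and
  `normalJet j (jetLift ε ν) = symmetrize ∘ ν`;
* §4 for a functional `D`, additive and homogeneous on the test functions supported in `W`
  (`IsLocallyLinearOn`), with `NormalOrderBelow D V (j+1)`: **`D h = D (jetLift ε (normalJet j h))`**
  for `h` flat below order `j` — `D` restricted to such `h` factors through the top normal jet
  (`NormalOrderBelow.apply_eq_apply_jetLift`).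

Everything is proved; the definitions are concrete; no named fact is introduced.

## References

* L. Hörmander, *The Analysis of Linear Partial Differential Operators I* (1983), Thm. 2.3.3, Thm. 2.3.5
  [HormanderALPDO1].
-/

noncomputable section

open Set Filter Topology Function Metric
open scoped ContDiff

namespace Literature.Analysis.Distribution

variable {B Z : Type*} [NormedAddCommGroup B] [NormedSpace ℝ B] [NormedAddCommGroup Z] [NormedSpace ℝ Z]

/-! ### 1. Normal jets as multilinear maps -/

section Jet

variable (B) in
/-- The space of order-`j` normal jets: continuous `j`-linear complex-valued maps on `B`. [folklore] -/
abbrev NormalJetSpace (j : ℕ) : Type _ := ContinuousMultilinearMap ℝ (fun _ : Fin j => B) ℂ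

/-- **The normal jet of order `j`** of `h : B × Z → ℂ` at the point `(0, z)` of the subspace `{0} × Z`:
`D^j h (0, z)` restricted to normal directions. [cite: HormanderALPDO1, Thm. 2.3.3] -/
def normalJet (j : ℕ) (h : B × Z → ℂ) (z : Z) : NormalJetSpace B j :=
  (iteratedFDeriv ℝ j h ((0 : B), z)).compContinuousLinearMap fun _ => ContinuousLinearMap.inl ℝ B Z

/-- `normalJet j h z v = D^j h(0, z)((v₁, 0), …, (v_j, 0))`. [folklore] -/
theorem normalJet_apply (j : ℕ) (h : B × Z → ℂ) (z : Z) (v : Fin j → B) :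
    normalJet j h z v = iteratedFDeriv ℝ j h ((0 : B), z) fun i => ((v i, 0) : B × Z) := by
  simp [normalJet, ContinuousMultilinearMap.compContinuousLinearMap_apply]

/-- **Normal word derivatives are values of the normal jet**: for `v : Fin j → B`,
`∂_{[(v₀,0),…]} h (x) = D^j h(x)((v₀,0),…)`. [folklore] -/
theorem vecWordDeriv_normalWord_ofFn {h : B × Z → ℂ} (hh : ContDiff ℝ ∞ h) :
    ∀ {j : ℕ} (v : Fin j → B) (x : B × Z),
      vecWordDeriv (normalWord (List.ofFn v)) h x = iteratedFDeriv ℝ j h x fun i => ((v i, 0) : B × Z)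
  | 0, v, x => by simp
  | j + 1, v, x => by
    rw [List.ofFn_succ, normalWord_cons, vecWordDeriv_cons]
    have hfun : vecWordDeriv (normalWord (List.ofFn fun i => v i.succ)) h =
        fun y => iteratedFDeriv ℝ j h y fun i => ((v i.succ, 0) : B × Z) :=
      funext (vecWordDeriv_normalWord_ofFn hh (fun i => v i.succ))
    have hdiff : DifferentiableAt ℝ (iteratedFDeriv ℝ j h) x :=
      (hh.differentiable_iteratedFDeriv (m := j) (mod_cast ENat.coe_lt_top j)) x
    have htuple : (fun i : Fin (j + 1) => ((v i, 0) : B × Z)) = Fin.cons ((v 0, 0) : B × Z) fun i => ((v i.succ, 0) : B × Z) := by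
      funext i; refine Fin.cases ?_ (fun k => ?_) i <;> simp
    rw [vecDeriv, hfun, fderiv_continuousMultilinear_apply_const_apply hdiff, htuple, iteratedFDeriv_succ_apply_left,
      Fin.cons_zero, Fin.tail_cons]

/-- At a point of the subspace: `∂_{normal word of v} h (0, z) = normalJet j h z v`. [folklore] -/
theorem vecWordDeriv_normalWord_ofFn_eq_normalJet {h : B × Z → ℂ} (hh : ContDiff ℝ ∞ h) {j : ℕ} (v : Fin j → B) (z : Z) :
    vecWordDeriv (normalWord (List.ofFn v)) h ((0 : B), z) = normalJet j h z v := by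
  rw [vecWordDeriv_normalWord_ofFn hh, normalJet_apply]

/-- **Flatness in terms of jets**: `NormalJetsVanishBelow j h ↔ normalJet i h = 0` for all `i < j`. [folklore] -/
theorem normalJetsVanishBelow_iff_normalJet {h : B × Z → ℂ} (hh : ContDiff ℝ ∞ h) (j : ℕ) :
    NormalJetsVanishBelow j h ↔ ∀ i < j, ∀ z : Z, normalJet i h z = 0 := by
  constructor
  · intro hflat i hi z
    ext v
    rw [← vecWordDeriv_normalWord_ofFn_eq_normalJet hh, zero_apply]
    exact hflat _ (by simpa using hi) z
  · intro hjet w hw z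
    have h1 := vecWordDeriv_normalWord_ofFn_eq_normalJet hh (fun i => w.get i) z
    rw [List.ofFn_get] at h1
    rw [h1, hjet _ hw z, zero_apply]

/-- `normalJet` is additive in `h` (smooth). [folklore] -/
theorem normalJet_add {f g : B × Z → ℂ} (hf : ContDiff ℝ ∞ f) (hg : ContDiff ℝ ∞ g) (j : ℕ) (z : Z) :
    normalJet j (f + g) z = normalJet j f z + normalJet j g z := by
  ext v
  simp only [normalJet_apply, add_apply]
  rw [iteratedFDeriv_add_apply (hf.contDiffAt.of_le (mod_cast le_top)) (hg.contDiffAt.of_le (mod_cast le_top))]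
  rfl

/-- `normalJet` is homogeneous in `h`. [folklore] -/
theorem normalJet_smul {f : B × Z → ℂ} (hf : ContDiff ℝ ∞ f) (c : ℂ) (j : ℕ) (z : Z) :
    normalJet j (c • f) z = c • normalJet j f z := by
  ext v
  simp only [normalJet_apply, smul_apply]
  rw [iteratedFDeriv_const_smul_apply (hf.contDiffAt.of_le (mod_cast le_top))]
  rfl

/-- `normalJet` of `f - g`. [folklore] -/
theorem normalJet_sub {f g : B × Z → ℂ} (hf : ContDiff ℝ ∞ f) (hg : ContDiff ℝ ∞ g) (j : ℕ) (z : Z) :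
    normalJet j (f - g) z = normalJet j f z - normalJet j g z := by
  have hneg : -g = (-1 : ℂ) • g := by funext x; simp
  have hgn : ContDiff ℝ ∞ (-g) := hg.neg
  rw [sub_eq_add_neg, normalJet_add hf hgn]
  conv_lhs => rw [hneg]
  rw [normalJet_smul hg, neg_one_smul ℂ (normalJet j g z), sub_eq_add_neg]

/-- `normalJet` is local: it only depends on `h` near `(0, z)`. [folklore] -/
theorem normalJet_congr_of_eventuallyEq {f g : B × Z → ℂ} {z : Z} (hfg : f =ᶠ[𝓝 ((0 : B), z)] g) (j : ℕ) :
    normalJet j f z = normalJet j g z := by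
  simp only [normalJet, (hfg.iteratedFDeriv ℝ j).eq_of_nhds]

/-- **The normal jet of a smooth function is symmetric.** [folklore] -/
theorem normalJet_comp_perm {h : B × Z → ℂ} (hh : ContDiff ℝ ∞ h) {j : ℕ} (z : Z) (v : Fin j → B)
    (σ : Equiv.Perm (Fin j)) : normalJet j h z (v ∘ σ) = normalJet j h z v := by
  rw [← vecWordDeriv_normalWord_ofFn_eq_normalJet hh, ← vecWordDeriv_normalWord_ofFn_eq_normalJet hh]
  have hperm : (normalWord (Z := Z) (List.ofFn (v ∘ σ))).Perm (normalWord (List.ofFn v)) :=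
    (Equiv.Perm.ofFn_comp_perm σ v).map _
  rw [vecWordDeriv_perm hh hperm]

/-- `z ↦ normalJet j h z` is smooth for smooth `h`. [folklore] -/
theorem contDiff_normalJet {h : B × Z → ℂ} (hh : ContDiff ℝ ∞ h) (j : ℕ) : ContDiff ℝ ∞ (normalJet j h) := by
  have h1 : ContDiff ℝ ∞ fun z : Z => iteratedFDeriv ℝ j h ((0 : B), z) :=
    (hh.iteratedFDeriv_right (m := ∞) (i := j) (by exact_mod_cast le_top)).comp
      ((contDiff_const (c := (0 : B))).prodMk contDiff_id)
  exact (ContinuousMultilinearMap.compContinuousLinearMapL (fun _ => ContinuousLinearMap.inl ℝ B Z)).contDiff.comp h1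

/-- Off the support of `h` the normal jet vanishes. [folklore] -/
theorem normalJet_eq_zero_of_notMem_tsupport {h : B × Z → ℂ} {z : Z} (hz : ((0 : B), z) ∉ tsupport h) (j : ℕ) :
    normalJet j h z = 0 := by
  have h0 : h =ᶠ[𝓝 ((0 : B), z)] (fun _ => 0) := notMem_tsupport_iff_eventuallyEq.1 hz
  have h1 : iteratedFDeriv ℝ j h ((0 : B), z) = 0 := by
    rw [(h0.iteratedFDeriv ℝ j).eq_of_nhds, iteratedFDeriv_fun_zero]; rfl
  ext v
  simp [normalJet_apply, h1]

/-- The support of `z ↦ normalJet j h z` lies over the support of `h`. [folklore] -/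
theorem tsupport_normalJet_subset (h : B × Z → ℂ) (j : ℕ) :
    tsupport (normalJet j h) ⊆ {z : Z | ((0 : B), z) ∈ tsupport h} := by
  have hclosed : IsClosed {z : Z | ((0 : B), z) ∈ tsupport h} :=
    (isClosed_tsupport h).preimage (Continuous.prodMk_right (0 : B))
  refine closure_minimal (fun z hz => ?_) hclosed
  by_contra hnot
  exact hz (normalJet_eq_zero_of_notMem_tsupport hnot j)

/-- `z ↦ normalJet j h z` has compact support when `h` has. [folklore] -/
theorem hasCompactSupport_normalJet {h : B × Z → ℂ} (hh : HasCompactSupport h) (j : ℕ) :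
    HasCompactSupport (normalJet j h) := by
  refine HasCompactSupport.intro' ((hh.image continuous_snd).of_isClosed_subset
    ((isClosed_tsupport h).preimage (Continuous.prodMk_right (0 : B))) ?_)
    ((isClosed_tsupport h).preimage (Continuous.prodMk_right (0 : B))) fun z hz => ?_
  · intro z hz
    exact ⟨((0 : B), z), hz, rfl⟩
  · exact normalJet_eq_zero_of_notMem_tsupport hz j

end Jet

/-! ### 2. Symmetrisation and the diagonal of a multilinear map -/

section Sym

/-- **Symmetrisation** `symmetrize m = (j!)⁻¹ Σ_{σ ∈ 𝔖_j} m ∘ σ`. [folklore] -/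
def symmetrize {j : ℕ} (m : NormalJetSpace B j) : NormalJetSpace B j :=
  ((Nat.factorial j : ℂ)⁻¹) • ∑ σ : Equiv.Perm (Fin j), m.domDomCongr σ

/-- `symmetrize m v = (j!)⁻¹ Σ_σ m (v ∘ σ)`. [folklore] -/
theorem symmetrize_apply {j : ℕ} (m : NormalJetSpace B j) (v : Fin j → B) :
    symmetrize m v = ((Nat.factorial j : ℂ)⁻¹) * ∑ σ : Equiv.Perm (Fin j), m (v ∘ σ) := by
  simp [symmetrize, Function.comp_def]

/-- `symmetrize` is additive. [folklore] -/
theorem symmetrize_add {j : ℕ} (m m' : NormalJetSpace B j) : symmetrize (m + m') = symmetrize m + symmetrize m' := by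
  ext v; simp [symmetrize_apply, Finset.sum_add_distrib, mul_add]

/-- `symmetrize` is homogeneous. [folklore] -/
theorem symmetrize_smul {j : ℕ} (c : ℂ) (m : NormalJetSpace B j) : symmetrize (c • m) = c • symmetrize m := by
  ext v; simp [symmetrize_apply, Finset.mul_sum, mul_left_comm]

/-- A symmetric multilinear map is its own symmetrisation. [folklore] -/
theorem symmetrize_eq_self_of_forall_comp_perm {j : ℕ} {m : NormalJetSpace B j}
    (hm : ∀ (v : Fin j → B) (σ : Equiv.Perm (Fin j)), m (v ∘ σ) = m v) : symmetrize m = m := by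
  ext v
  rw [symmetrize_apply, Finset.sum_congr rfl fun σ _ => hm v σ, Finset.sum_const, Finset.card_univ,
    Fintype.card_perm, Fintype.card_fin, nsmul_eq_mul, ← mul_assoc,
    inv_mul_cancel₀ (by exact_mod_cast (Nat.factorial_pos j).ne'), one_mul]

/-- **The normal jet of a smooth function is fixed by symmetrisation.** [folklore] -/
theorem symmetrize_normalJet {h : B × Z → ℂ} (hh : ContDiff ℝ ∞ h) (j : ℕ) (z : Z) :
    symmetrize (normalJet j h z) = normalJet j h z :=
  symmetrize_eq_self_of_forall_comp_perm fun v σ => normalJet_comp_perm hh z v σ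

/-- **The diagonal** `b ↦ m (b, …, b)` of a `j`-linear map. [folklore] -/
def diagFn {j : ℕ} (m : NormalJetSpace B j) (b : B) : ℂ := m fun _ => b

/-- The diagonal is `m` composed with the linear diagonal embedding `B → B^j`. [folklore] -/
theorem diagFn_eq_comp {j : ℕ} (m : NormalJetSpace B j) :
    diagFn m = (m : (Fin j → B) → ℂ) ∘ (ContinuousLinearMap.pi fun _ : Fin j => ContinuousLinearMap.id ℝ B) := by
  funext b; rfl

/-- The diagonal is smooth. [folklore] -/
theorem contDiff_diagFn {j : ℕ} (m : NormalJetSpace B j) : ContDiff ℝ ∞ (diagFn m) := by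
  rw [diagFn_eq_comp]
  exact m.contDiff.comp (ContinuousLinearMap.contDiff _)

/-- The diagonal on symmetrised maps: `diagFn (symmetrize m) = diagFn m`. [folklore] -/
theorem diagFn_symmetrize {j : ℕ} (m : NormalJetSpace B j) : diagFn (symmetrize m) = diagFn m := by
  funext b
  rw [diagFn, diagFn, symmetrize_apply]
  have hconst : ∀ σ : Equiv.Perm (Fin j), m ((fun _ : Fin j => b) ∘ σ) = m fun _ => b := fun σ => rfl
  rw [Finset.sum_congr rfl fun σ _ => hconst σ, Finset.sum_const, Finset.card_univ, Fintype.card_perm,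
    Fintype.card_fin, nsmul_eq_mul, ← mul_assoc, inv_mul_cancel₀ (by exact_mod_cast (Nat.factorial_pos j).ne'), one_mul]

/-- **Homogeneity of the diagonal**: `diagFn m (t • b) = t^j diagFn m b`. [folklore] -/
theorem diagFn_smul {j : ℕ} (m : NormalJetSpace B j) (t : ℝ) (b : B) : diagFn m (t • b) = (t : ℂ) ^ j * diagFn m b := by
  rw [diagFn, diagFn, show (fun _ : Fin j => t • b) = fun i => (fun _ : Fin j => t) i • (fun _ : Fin j => b) i from rfl,
    m.map_smul_univ]
  simp [Finset.prod_const, Complex.real_smul]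

/-- **The `j`-th derivative of the diagonal** at any point: `D^j (diagFn m)(x)(v) = Σ_σ m (v ∘ σ) = j! symmetrize m v`.
[folklore] -/
theorem iteratedFDeriv_diagFn_self {j : ℕ} (m : NormalJetSpace B j) (x : B) (v : Fin j → B) :
    iteratedFDeriv ℝ j (diagFn m) x v = (Nat.factorial j : ℂ) * symmetrize m v := by
  rw [show diagFn m = fun x => m fun _ => x from rfl, ContinuousMultilinearMap.iteratedFDeriv_comp_diagonal,
    symmetrize_apply, ← mul_assoc, mul_inv_cancel₀ (by exact_mod_cast (Nat.factorial_pos j).ne'), one_mul]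
  rfl

/-- **All other derivatives of the diagonal vanish at `0`**: from `diagFn m (t b) = t^j diagFn m (b)`,
`t^i D^i(diagFn m)(0) = t^j D^i(diagFn m)(0)` for all `t`. [folklore] -/
theorem iteratedFDeriv_diagFn_zero_of_ne {j i : ℕ} (m : NormalJetSpace B j) (hij : i ≠ j) (v : Fin i → B) :
    iteratedFDeriv ℝ i (diagFn m) 0 v = 0 := by
  have hsm := contDiff_diagFn m
  -- compare the `i`-th derivatives at `0` of `diagFn m ∘ (2 •)` computed in two ways
  set T : B →L[ℝ] B := (2 : ℝ) • ContinuousLinearMap.id ℝ B with hT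
  have hcomp : (diagFn m) ∘ T = fun b => ((2 : ℝ) : ℂ) ^ j * diagFn m b := by
    funext b; simp [hT, diagFn_smul]
  have h1 : iteratedFDeriv ℝ i ((diagFn m) ∘ T) 0 v = ((2 : ℝ) : ℂ) ^ i * iteratedFDeriv ℝ i (diagFn m) 0 v := by
    rw [T.iteratedFDeriv_comp_right hsm 0 (mod_cast le_top),
      ContinuousMultilinearMap.compContinuousLinearMap_apply, map_zero]
    have : (fun k : Fin i => T (v k)) = fun k => (fun _ : Fin i => (2 : ℝ)) k • v k := by
      funext k; simp [hT]
    rw [this, ContinuousMultilinearMap.map_smul_univ]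
    simp [Finset.prod_const, Complex.real_smul]
  have h2 : iteratedFDeriv ℝ i ((diagFn m) ∘ T) 0 v = ((2 : ℝ) : ℂ) ^ j * iteratedFDeriv ℝ i (diagFn m) 0 v := by
    rw [hcomp, show (fun b => ((2 : ℝ) : ℂ) ^ j * diagFn m b) = (((2 : ℝ) : ℂ) ^ j) • diagFn m from rfl,
      iteratedFDeriv_const_smul_apply (hsm.contDiffAt.of_le (mod_cast le_top))]
    rfl
  have h12 : (((2 : ℝ) : ℂ) ^ i - ((2 : ℝ) : ℂ) ^ j) * iteratedFDeriv ℝ i (diagFn m) 0 v = 0 := by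
    rw [sub_mul, ← h1, ← h2, sub_self]
  rcases mul_eq_zero.1 h12 with h | h
  · exfalso
    apply hij
    have h' : ((2 : ℝ) : ℂ) ^ i = ((2 : ℝ) : ℂ) ^ j := sub_eq_zero.1 h
    have h'' : ((2 : ℕ) : ℂ) ^ i = ((2 : ℕ) : ℂ) ^ j := by push_cast at h' ⊢; exact h'
    exact Nat.pow_right_injective le_rfl (by exact_mod_cast h'')
  · exact h

end Sym

/-! ### 3. The jet lift -/

section Lift

/-- Joint smoothness of the evaluation `(m, b) ↦ m(b, …, b)`. [folklore] -/
theorem contDiff_diagFn_uncurry (j : ℕ) : ContDiff ℝ ∞ fun p : NormalJetSpace B j × B => diagFn p.1 p.2 := by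
  have h1 : ContDiff ℝ ∞ fun p : NormalJetSpace B j × (Fin j → B) => p.1 p.2 :=
    (ContinuousLinearMap.id ℝ (NormalJetSpace B j)).analyticOnNhd_uncurry_of_multilinear.contDiff
  exact h1.comp (contDiff_fst.prodMk ((ContinuousLinearMap.pi fun _ : Fin j => ContinuousLinearMap.id ℝ B).contDiff.comp contDiff_snd))

variable [FiniteDimensional ℝ B]

/-- **The jet lift** of `ν : Z → (B^{⊗j})^*`: `jetLift ε ν (b, z) = χ(b/ε) (j!)⁻¹ ν(z)(b, …, b)`.
[cite: HormanderALPDO1, Thm. 2.3.5 (proof)] -/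
def jetLift {j : ℕ} (ε : ℝ) (ν : Z → NormalJetSpace B j) (x : B × Z) : ℂ :=
  normalCutoff ε x * (((Nat.factorial j : ℂ)⁻¹) * diagFn (ν x.2) x.1)

/-- The jet lift of a smooth `ν` is smooth. [folklore] -/
theorem contDiff_jetLift {j : ℕ} (ε : ℝ) {ν : Z → NormalJetSpace B j} (hν : ContDiff ℝ ∞ ν) : ContDiff ℝ ∞ (jetLift ε ν) := by
  unfold jetLift
  refine (contDiff_normalCutoff (B := B) (Z := Z) ε).mul (contDiff_const.mul ?_)
  exact (contDiff_diagFn_uncurry j).comp ((hν.comp contDiff_snd).prodMk contDiff_fst)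

/-- The support of the jet lift: `‖b‖ ≤ 2ε` and `z ∈ spt ν`. [folklore] -/
theorem tsupport_jetLift_subset {j : ℕ} {ε : ℝ} (hε : 0 < ε) (ν : Z → NormalJetSpace B j) :
    tsupport (jetLift ε ν) ⊆ {x : B × Z | ‖x.1‖ ≤ 2 * ε} ∩ Prod.snd ⁻¹' tsupport ν := by
  have hclosed : IsClosed ({x : B × Z | ‖x.1‖ ≤ 2 * ε} ∩ Prod.snd ⁻¹' tsupport ν) :=
    (isClosed_le (continuous_norm.comp continuous_fst) continuous_const).inter ((isClosed_tsupport ν).preimage continuous_snd)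
  refine closure_minimal (fun x hx => ⟨?_, ?_⟩) hclosed
  · by_contra hfar
    rw [mem_setOf_eq, not_le] at hfar
    apply hx
    have h0 : normalCutoff (Z := Z) ε x = 0 := by
      have := (exists_bound_vecWordDeriv_normalCutoff (B := B) (Z := Z) []).choose_spec.2 ε hε x
      simpa using this.2 hfar
    simp [jetLift, h0]
  · by_contra hz
    apply hx
    have h0 : ν x.2 = 0 := image_eq_zero_of_notMem_tsupport hz
    simp [jetLift, h0, diagFn]

/-- The jet lift of a compactly supported `ν` has compact support (`B` finite-dimensional). [folklore] -/
theorem hasCompactSupport_jetLift {j : ℕ} {ε : ℝ} (hε : 0 < ε) {ν : Z → NormalJetSpace B j} (hν : HasCompactSupport ν) :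
    HasCompactSupport (jetLift ε ν) := by
  have hK : IsCompact (closedBall (0 : B) (2 * ε) ×ˢ tsupport ν) := (isCompact_closedBall _ _).prod hν
  refine hK.of_isClosed_subset (isClosed_tsupport _) ((tsupport_jetLift_subset hε ν).trans ?_)
  rintro x ⟨hx1, hx2⟩
  exact ⟨by simpa [mem_closedBall, dist_zero_right] using hx1, hx2⟩

/-- The jet lift is a test function. [folklore] -/
theorem isTestFn_jetLift {j : ℕ} {ε : ℝ} (hε : 0 < ε) {ν : Z → NormalJetSpace B j} (hν : ContDiff ℝ ∞ ν)
    (hνc : HasCompactSupport ν) : IsTestFn (jetLift ε ν) :=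
  ⟨contDiff_jetLift ε hν, hasCompactSupport_jetLift hε hνc⟩

omit [NormedAddCommGroup Z] [NormedSpace ℝ Z] in
/-- The jet lift only sees the symmetrisation: `jetLift ε (symmetrize ∘ ν) = jetLift ε ν`. [folklore] -/
theorem jetLift_symmetrize {j : ℕ} (ε : ℝ) (ν : Z → NormalJetSpace B j) :
    jetLift ε (fun z => symmetrize (ν z)) = jetLift ε ν := by
  funext x; simp [jetLift, diagFn_symmetrize]

omit [NormedAddCommGroup Z] [NormedSpace ℝ Z] in
/-- The jet lift is additive in `ν`. [folklore] -/
theorem jetLift_add {j : ℕ} (ε : ℝ) (ν ν' : Z → NormalJetSpace B j) :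
    jetLift ε (ν + ν') = jetLift ε ν + jetLift ε ν' := by
  funext x; simp [jetLift, diagFn]; ring

omit [NormedAddCommGroup Z] [NormedSpace ℝ Z] in
/-- The jet lift is homogeneous in `ν`. [folklore] -/
theorem jetLift_smul {j : ℕ} (ε : ℝ) (c : ℂ) (ν : Z → NormalJetSpace B j) :
    jetLift ε (c • ν) = c • jetLift ε ν := by
  funext x; simp [jetLift, diagFn]; ring

omit [FiniteDimensional ℝ B] in
/-- **The normal jet is the iterated derivative of the slice `b ↦ F(b, z)` at `0`.** [folklore] -/
theorem normalJet_apply_eq_iteratedFDeriv_slice {F : B × Z → ℂ} (hF : ContDiff ℝ ∞ F) (i : ℕ) (z : Z) (v : Fin i → B) :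
    normalJet i F z v = iteratedFDeriv ℝ i (fun b => F (b, z)) 0 v := by
  have hslice : (fun b : B => F (b, z)) = (fun y : B × Z => F (y + ((0 : B), z))) ∘ ContinuousLinearMap.inl ℝ B Z := by
    funext b; simp
  have hF' : ContDiff ℝ ∞ fun y : B × Z => F (y + ((0 : B), z)) := hF.comp (contDiff_id.add contDiff_const)
  rw [hslice, (ContinuousLinearMap.inl ℝ B Z).iteratedFDeriv_comp_right hF' 0 (mod_cast le_top),
    ContinuousMultilinearMap.compContinuousLinearMap_apply, iteratedFDeriv_comp_add_right, normalJet_apply]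
  simp

/-- The jets of the jet lift are those of `(j!)⁻¹ diagFn (ν z)` at `0`. [folklore] -/
theorem normalJet_jetLift_apply {j : ℕ} {ε : ℝ} (hε : 0 < ε) {ν : Z → NormalJetSpace B j} (hν : ContDiff ℝ ∞ ν)
    (i : ℕ) (z : Z) (v : Fin i → B) :
    normalJet i (jetLift ε ν) z v = ((Nat.factorial j : ℂ)⁻¹) * iteratedFDeriv ℝ i (diagFn (ν z)) 0 v := by
  rw [normalJet_apply_eq_iteratedFDeriv_slice (contDiff_jetLift ε hν) i z v]
  -- near `b = 0` the slice is `(j!)⁻¹ diagFn (ν z)`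
  have hev : (fun b : B => jetLift ε ν (b, z)) =ᶠ[𝓝 (0 : B)]
      fun b => ((Nat.factorial j : ℂ)⁻¹) • diagFn (ν z) b := by
    have hopen : IsOpen {b : B | ‖b‖ < ε} := isOpen_lt continuous_norm continuous_const
    filter_upwards [hopen.mem_nhds (by simpa using hε)] with b hb
    rw [jetLift, normalCutoff_eq_one hε (le_of_lt hb), one_mul, smul_eq_mul]
  rw [(hev.iteratedFDeriv ℝ i).eq_of_nhds, show (fun b => ((Nat.factorial j : ℂ)⁻¹) • diagFn (ν z) b) =
      ((Nat.factorial j : ℂ)⁻¹) • diagFn (ν z) from rfl,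
    iteratedFDeriv_const_smul_apply ((contDiff_diagFn (ν z)).contDiffAt.of_le (mod_cast le_top)), smul_apply, smul_eq_mul]

/-- **The top jet of the jet lift**: `normalJet j (jetLift ε ν) z = symmetrize (ν z)`.
[cite: HormanderALPDO1, Thm. 2.3.5 (proof)] -/
theorem normalJet_jetLift_self {j : ℕ} {ε : ℝ} (hε : 0 < ε) {ν : Z → NormalJetSpace B j} (hν : ContDiff ℝ ∞ ν) (z : Z) :
    normalJet j (jetLift ε ν) z = symmetrize (ν z) := by
  ext v
  rw [normalJet_jetLift_apply hε hν, iteratedFDeriv_diagFn_self, ← mul_assoc,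
    inv_mul_cancel₀ (by exact_mod_cast (Nat.factorial_pos j).ne'), one_mul]

/-- **The other jets of the jet lift vanish**: `normalJet i (jetLift ε ν) z = 0` for `i ≠ j`.
[cite: HormanderALPDO1, Thm. 2.3.5 (proof)] -/
theorem normalJet_jetLift_of_ne {j : ℕ} {ε : ℝ} (hε : 0 < ε) {ν : Z → NormalJetSpace B j} (hν : ContDiff ℝ ∞ ν) {i : ℕ}
    (hij : i ≠ j) (z : Z) : normalJet i (jetLift ε ν) z = 0 := by
  ext v
  rw [normalJet_jetLift_apply hε hν, iteratedFDeriv_diagFn_zero_of_ne (ν z) hij, mul_zero, zero_apply]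

/-- The jet lift is flat below order `j`. [folklore] -/
theorem normalJetsVanishBelow_jetLift {j : ℕ} {ε : ℝ} (hε : 0 < ε) {ν : Z → NormalJetSpace B j} (hν : ContDiff ℝ ∞ ν) :
    NormalJetsVanishBelow j (jetLift ε ν) := by
  rw [normalJetsVanishBelow_iff_normalJet (contDiff_jetLift ε hν)]
  intro i hi z
  exact normalJet_jetLift_of_ne hε hν hi.ne z

end Lift

/-! ### 4. Functionals of bounded normal order factor through the top jet -/

section Factor

variable {X : Type*} [NormedAddCommGroup X] [NormedSpace ℝ X]

/-- **Additivity and homogeneity of `D` on the test functions supported in `W`** (the part of linearity of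
a distribution used locally). [cite: HormanderALPDO1, Def. 2.1.1] -/
structure IsLocallyLinearOn (W : Set X) (D : (X → ℂ) → ℂ) : Prop where
  /-- additivity -/
  add : ∀ f g : X → ℂ, IsTestFn f → IsTestFn g → tsupport f ⊆ W → tsupport g ⊆ W → D (f + g) = D f + D g
  /-- homogeneity -/
  smul : ∀ (c : ℂ) (f : X → ℂ), IsTestFn f → tsupport f ⊆ W → D (c • f) = c * D f

/-- `D (f - g) = D f - D g`. [folklore] -/
theorem IsLocallyLinearOn.sub {W : Set X} {D : (X → ℂ) → ℂ} (hD : IsLocallyLinearOn W D) {f g : X → ℂ}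
    (hf : IsTestFn f) (hg : IsTestFn g) (hfW : tsupport f ⊆ W) (hgW : tsupport g ⊆ W) : D (f - g) = D f - D g := by
  have hneg : -g = (-1 : ℂ) • g := by funext x; simp
  have hgn : IsTestFn (-g) := hg.neg
  have hgnW : tsupport (-g) ⊆ W := by rwa [tsupport, Function.support_neg]
  rw [sub_eq_add_neg, hD.add f (-g) hf hgn hfW hgnW, hneg, hD.smul (-1) g hg hgW]
  ring

/-- Monotonicity of `IsLocallyLinearOn` in the set. [folklore] -/
theorem IsLocallyLinearOn.mono {W W' : Set X} {D : (X → ℂ) → ℂ} (hD : IsLocallyLinearOn W D) (h : W' ⊆ W) :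
    IsLocallyLinearOn W' D :=
  ⟨fun f g hf hg hfW hgW => hD.add f g hf hg (hfW.trans h) (hgW.trans h),
    fun c f hf hfW => hD.smul c f hf (hfW.trans h)⟩

omit [NormedSpace ℝ X] in
/-- `tsupport (f - g) ⊆ tsupport f ∪ tsupport g`. [folklore] -/
theorem tsupport_sub_subset' (f g : X → ℂ) : tsupport (f - g) ⊆ tsupport f ∪ tsupport g := by
  rw [sub_eq_add_neg]
  refine (tsupport_add _ _).trans (union_subset_union le_rfl ?_)
  rw [tsupport, tsupport, Function.support_neg]

variable [FiniteDimensional ℝ B]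

/-- **Functionals of bounded normal order factor through the top normal jet**: if
`NormalOrderBelow D V (j+1)` and `h` is flat below order `j`, then `D h = D (jetLift ε (normalJet j h))`
(whenever both are supported in `V`): `h - jetLift ε (normalJet j h)` is flat below order `j + 1`.
[cite: HormanderALPDO1, Thm. 2.3.5 (proof)] -/
theorem NormalOrderBelow.apply_eq_apply_jetLift {D : (B × Z → ℂ) → ℂ} {W V : Set (B × Z)} {j : ℕ}
    (hlin : IsLocallyLinearOn W D) (hVW : V ⊆ W) (hD : NormalOrderBelow D V (j + 1)) {ε : ℝ} (hε : 0 < ε)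
    {h : B × Z → ℂ} (hh : IsTestFn h) (hhV : tsupport h ⊆ V) (hflat : NormalJetsVanishBelow j h)
    (hliftV : tsupport (jetLift ε (normalJet j h)) ⊆ V) :
    D h = D (jetLift ε (normalJet j h)) := by
  have hν : ContDiff ℝ ∞ (normalJet j h) := contDiff_normalJet hh.contDiff j
  have hνc : HasCompactSupport (normalJet j h) := hasCompactSupport_normalJet hh.hasCompactSupport j
  have hL : IsTestFn (jetLift ε (normalJet j h)) := isTestFn_jetLift hε hν hνc
  have hsub : ContDiff ℝ ∞ (h - jetLift ε (normalJet j h)) := hh.contDiff.sub hL.contDiff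
  have hflat' : NormalJetsVanishBelow (j + 1) (h - jetLift ε (normalJet j h)) := by
    rw [normalJetsVanishBelow_iff_normalJet hsub]
    intro i hi z
    rw [normalJet_sub hh.contDiff hL.contDiff]
    by_cases hij : i = j
    · subst hij
      rw [normalJet_jetLift_self hε hν, symmetrize_normalJet hh.contDiff, sub_self]
    · have hij' : i < j := by omega
      rw [normalJet_jetLift_of_ne hε hν hij, sub_zero]
      exact ((normalJetsVanishBelow_iff_normalJet hh.contDiff j).1 hflat) i hij' z
  have h0 := hD _ (hh.sub hL) ((tsupport_sub_subset' h (jetLift ε (normalJet j h))).trans (union_subset hhV hliftV)) hflat'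
  rw [hlin.sub hh hL (hhV.trans hVW) (hliftV.trans hVW)] at h0
  exact sub_eq_zero.1 h0

end Factor



end Literature.Analysis.Distribution
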